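import Summits.RiemannHypothesis.RiemannHypothesis.Theorems.HandoffWindow
import Mathlib.Analysis.Calculus.BumpFunction.Basic
import Mathlib.Analysis.Calculus.BumpFunction.FiniteDimension
import Mathlib.Algebra.QuadraticDiscriminant
import Literature.NumberTheory.LFunctions.WeilWindowSimpleEven
import HarnessLib

/-!
# HANDOFF, Schur form: translation invariance, the edge self-energy brick, and the coupling reduction (rh-explicit, track «HANDOFF», seat prove-2)

HONEST FRAMING. Nothing here proves or approaches RH. This file turns ATTEMPT-2 of the seat into checked statements:

* `weilConv_weilReflect_translate`, `weilSemilocalQuadratic_translate`, `weilQuadratic_translate` — the kernel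
  `k = g ⋆ g̃`, hence every (semilocal) Weil form, is invariant under translating `g` (PROVED).
* `re_weilSemilocalQuadratic_nonneg_of_narrow` — THE UNIFORM BRICK: for every finite `S ∋ 2` and every Weil test
  function `h` supported in an interval of half-length `(log 3)/2` centred ANYWHERE, `0 ≤ Re Q_S(h)` (translation +
  coincidence with the full form below the prime `3` + the tree theorem `weilPositivityOn_log_three_half`). In the
  HANDOFF window `[(log q)/2, (log q′)/2]` each edge layer has half-length `≤ (log 2)/4 < (log 3)/2`, so the self-energy
  of a single edge piece of the `{p<q}`-form is non-negative for EVERY `q ≥ 3` (PROVED).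
* `IsEdgeLayer`, `crossRe`, `EdgeNonneg`, `HandoffCoupling` — the blocks of the Schur decomposition
  `g = u + h` (`u ∈ C((log q)/2)`, `h` an edge-layer function with overlap `η`) and the COUPLING LAW
  `(crossRe u h)² ≤ Re Q(u) · Re Q(h)`; `handoffH_of_coupling` — PROVED reduction
  `WeilPositivityOn((log q)/2) ∧ EdgeNonneg ∧ HandoffCoupling → HandoffH q q′` (smooth partition of unity by a
  `ContDiffBump`, then `a, c ≥ 0 ∧ b² ≤ ac ⇒ a + 2b + c ≥ 0`). The coupling law is where the RH-strength content
  sits (ATTEMPT-2 §3(iii), the exterior-potential matching law); it is stated, not claimed.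
* `handoffCoupling_of_weilPositivityOn`, `handoffH_iff_edgeNonneg_and_coupling` — the CONVERSE (Cauchy–Schwarz along
  the real line `u + t·h`, via `weilQuadratic_add`/`_const_mul` and the discriminant) and the packaged EQUIVALENCE
  `H(q) ⟺ EdgeNonneg ∧ HandoffCoupling` given the induction hypothesis (idea-2's L1, typed; PROVED).
* `SliverBound` — the elementary sliver estimate of ATTEMPT-1 (0.1), stated as a `Prop` (not yet proved here).
-/

set_option linter.dupNamespace false

noncomputable section

open Complex Filter Set MeasureTheory Metric Literature.NumberTheory.LFunctions
open scoped Real Topology ComplexConjugate ContDiff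

namespace Summit.RiemannHypothesis.RiemannHypothesis.Theorems.Handoff

variable {g h u : ℝ → ℂ} {S : Finset ℕ} {q q' : ℕ}

/-! ## §1 Translation invariance -/

/-- The kernel `k = g ⋆ g̃` is translation invariant: `(τ_c g) ⋆ (τ_c g)~ = g ⋆ g̃`, `(τ_c g)(x) = g(x − c)`. [folklore] -/
theorem weilConv_weilReflect_translate (g : ℝ → ℂ) (c : ℝ) :
    weilConv (fun x ↦ g (x - c)) (weilReflect fun x ↦ g (x - c)) = weilConv g (weilReflect g) := by
  funext t
  rw [weilConv_apply, weilConv_apply]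
  unfold weilReflect
  have e : (fun u : ℝ ↦ g (u - c) * conj (g (-(t - u) - c))) =
      fun u : ℝ ↦ (fun v : ℝ ↦ g v * conj (g (-(t - v)))) (u - c) := by
    funext u
    simp only
    congr 3
    ring
  rw [e, integral_sub_right_eq_self (fun v : ℝ ↦ g v * conj (g (-(t - v)))) c]

/-- Every semilocal Weil form is translation invariant. [folklore] -/
theorem weilSemilocalQuadratic_translate (S : Finset ℕ) (g : ℝ → ℂ) (c : ℝ) :
    weilSemilocalQuadratic S (fun x ↦ g (x - c)) = weilSemilocalQuadratic S g := by
  unfold weilSemilocalQuadratic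
  rw [weilConv_weilReflect_translate]

/-- Weil's form is translation invariant. [folklore] -/
theorem weilQuadratic_translate (g : ℝ → ℂ) (c : ℝ) :
    weilQuadratic (fun x ↦ g (x - c)) = weilQuadratic g := by
  unfold weilQuadratic
  rw [weilConv_weilReflect_translate]

/-! ## §2 The uniform brick: narrow test functions have non-negative semilocal energy, wherever they sit -/

/-- `tsupport (f ∘ φ) ⊆ φ ⁻¹' tsupport f` for continuous `φ`. [folklore] -/
theorem tsupport_comp_subset_preimage_of_continuous {M : Type*} [Zero M] (f : ℝ → M) {φ : ℝ → ℝ}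
    (hφ : Continuous φ) : tsupport (f ∘ φ) ⊆ φ ⁻¹' tsupport f :=
  closure_minimal (fun x hx ↦ subset_closure (by simpa [Function.mem_support] using hx))
    ((isClosed_tsupport f).preimage hφ)

/-- Re-centring a Weil test function supported in `[c − a, c + a]` gives one supported in `[−a, a]`. [folklore] -/
theorem isWeilTest_recentre (hh : IsWeilTest h) (c : ℝ) : IsWeilTest (fun x ↦ h (x + c)) :=
  ⟨hh.1.comp (contDiff_id.add contDiff_const), hh.2.comp_homeomorph (Homeomorph.addRight c)⟩

/-- Support of the re-centred function. [folklore] -/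
theorem tsupport_recentre_subset {a c : ℝ} (hsupp : tsupport h ⊆ Icc (c - a) (c + a)) :
    tsupport (fun x ↦ h (x + c)) ⊆ Icc (-a) a := by
  intro x hx
  have hφ : Continuous (fun x : ℝ ↦ x + c) := continuous_id.add continuous_const
  have hx' : x ∈ (fun x : ℝ ↦ x + c) ⁻¹' tsupport h := tsupport_comp_subset_preimage_of_continuous h hφ hx
  have hmem : x + c ∈ Icc (c - a) (c + a) := hsupp hx'
  rw [Set.mem_Icc] at hmem
  exact ⟨by linarith [hmem.1], by linarith [hmem.2]⟩

/-- Below the prime `3` only the atom `2` is visible. [folklore] -/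
theorem primeFactors_subset_of_le_two (h2 : 2 ∈ S) : ∀ n ≤ 2, IsPrimePow n → n.primeFactors ⊆ S :=
  fun n hn hp ↦ (primeFactors_subset_two_of_le_two n hn hp).trans (Finset.singleton_subset_iff.2 h2)

/-- **The uniform brick.** For every finite `S ∋ 2`, every centre `c` and every Weil test function `h` with
`tsupport h ⊆ [c − (log 3)/2, c + (log 3)/2]`: `0 ≤ Re Q_S(h)`. (Translate to the origin; there `Q_S = Q` since only
the atom `2 ∈ S` is visible; apply the tree theorem `weilPositivityOn_log_three_half`.) In the HANDOFF window of
consecutive primes `q < q′` each edge layer `[(log q)/2, b]`, `b ≤ (log q′)/2`, has length `≤ (log 2)/2` by Bertrand,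
so a single edge piece of the `{p < q}`-form (`q ≥ 3`) always has non-negative energy — uniformly in `q`.
[cite: Yoshida1992, Thm 1 (p. 310) via the tree's (log 3)/2 certificate; translation = folklore] -/
theorem re_weilSemilocalQuadratic_nonneg_of_narrow (h2 : 2 ∈ S) (hh : IsWeilTest h) {c : ℝ}
    (hsupp : tsupport h ⊆ Icc (c - Real.log 3 / 2) (c + Real.log 3 / 2)) :
    0 ≤ (weilSemilocalQuadratic S h).re := by
  set g : ℝ → ℂ := fun x ↦ h (x + c) with hg_def
  have hg : IsWeilTest g := isWeilTest_recentre hh c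
  have hgs : tsupport g ⊆ Icc (-(Real.log 3 / 2)) (Real.log 3 / 2) := tsupport_recentre_subset hsupp
  have hback : (fun x ↦ g (x - c)) = h := by
    funext x
    simp [hg_def]
  have h3 : Real.log (((2 : ℕ) : ℝ) + 1) / 2 = Real.log 3 / 2 := by norm_num
  have hgs' : tsupport g ⊆ Icc (-(Real.log (((2 : ℕ) : ℝ) + 1) / 2)) (Real.log (((2 : ℕ) : ℝ) + 1) / 2) := by
    rwa [h3]
  rw [← hback, weilSemilocalQuadratic_translate,
    weilSemilocalQuadratic_eq_weilQuadratic_of_forall hg (primeFactors_subset_of_le_two h2) hgs']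
  exact weilPositivityOn_log_three_half g hg hgs

/-- The same for Weil's full form (no hypothesis on primes: below `3` the full form and `Q_{{2}}` agree). [cite: Yoshida1992, Thm 1 (p. 310); translation = folklore] -/
theorem re_weilQuadratic_nonneg_of_narrow (hh : IsWeilTest h) {c : ℝ}
    (hsupp : tsupport h ⊆ Icc (c - Real.log 3 / 2) (c + Real.log 3 / 2)) :
    0 ≤ (weilQuadratic h).re := by
  set g : ℝ → ℂ := fun x ↦ h (x + c) with hg_def
  have hg : IsWeilTest g := isWeilTest_recentre hh c
  have hgs : tsupport g ⊆ Icc (-(Real.log 3 / 2)) (Real.log 3 / 2) := tsupport_recentre_subset hsupp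
  have hback : (fun x ↦ g (x - c)) = h := by
    funext x
    simp [hg_def]
  rw [← hback, weilQuadratic_translate]
  exact weilPositivityOn_log_three_half g hg hgs

/-! ## §3 The Schur blocks and the coupling reduction -/

/-- An **edge-layer function** for the window of `q` with overlap `η` and half-width `b`: a Weil test function
supported in `[−b, b]` that vanishes on the open inner core `|x| < (log q)/2 − η`. [this track, ATTEMPT-2 §2] -/
def IsEdgeLayer (q : ℕ) (η b : ℝ) (h : ℝ → ℂ) : Prop :=
  IsWeilTest h ∧ tsupport h ⊆ Icc (-b) b ∧ ∀ x : ℝ, |x| < Real.log q / 2 - η → h x = 0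

/-- The real cross term of Weil's form by polarisation: `Re Q(u + h) = Re Q(u) + Re Q(h) + 2·crossRe u h`.
[this track, ATTEMPT-2 §2 (the off-diagonal block B)] -/
def crossRe (u h : ℝ → ℂ) : ℝ :=
  ((weilQuadratic (u + h)).re - (weilQuadratic u).re - (weilQuadratic h).re) / 2

/-- Polarisation identity (by definition of `crossRe`). [folklore] -/
theorem re_weilQuadratic_add (u h : ℝ → ℂ) :
    (weilQuadratic (u + h)).re = (weilQuadratic u).re + (weilQuadratic h).re + 2 * crossRe u h := by
  unfold crossRe
  ring

/-- **Block C ≥ 0**: every edge-layer function of the window `[(log q)/2, (log q′)/2]` (overlap `η`) has non-negative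
Weil energy. For a ONE-SIDED edge piece this is `re_weilQuadratic_nonneg_of_narrow` (uniform in `q`); the two-sided
statement also contains the cross term between the two edge pieces at lag `≈ log q` (ATTEMPT-2 §3(ii)(b)).
[this track, ATTEMPT-2 §3(ii)] -/
def EdgeNonneg (q q' : ℕ) (η : ℝ) : Prop :=
  ∀ b ∈ Icc (Real.log q / 2) (Real.log q' / 2), ∀ h : ℝ → ℂ, IsEdgeLayer q η b h → 0 ≤ (weilQuadratic h).re

/-- **The COUPLING LAW (block B against A and C)**: for `u ∈ C((log q)/2)` and `h` an edge-layer function,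
`(crossRe u h)² ≤ Re Q(u) · Re Q(h)`. Forced by RH (Cauchy–Schwarz in the PSD form); quantitatively it says the
exterior Weil potential of every near-null mode of the RH-free form `Q_{S<q}|C((log q)/2)` is `√ε`-small on the new
layer (ATTEMPT-2 (ML)). Stated, NOT claimed. [this track, ATTEMPT-2 §3(iii)] -/
def HandoffCoupling (q q' : ℕ) (η : ℝ) : Prop :=
  ∀ b ∈ Icc (Real.log q / 2) (Real.log q' / 2), ∀ u h : ℝ → ℂ, IsWeilTest u →
    tsupport u ⊆ Icc (-(Real.log q / 2)) (Real.log q / 2) → IsEdgeLayer q η b h →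
      (crossRe u h) ^ 2 ≤ (weilQuadratic u).re * (weilQuadratic h).re

/-- `a, c ≥ 0` and `b² ≤ ac` give `a + c + 2b ≥ 0` (the `2 × 2` Schur step). [folklore] -/
theorem add_add_two_mul_nonneg_of_sq_le {a b c : ℝ} (ha : 0 ≤ a) (hc : 0 ≤ c) (hb : b ^ 2 ≤ a * c) :
    0 ≤ a + c + 2 * b := by
  rcases le_or_gt 0 (a + c + 2 * b) with h0 | hneg
  · exact h0
  · exfalso
    have hpos : 0 < -(a + c + 2 * b) := by linarith
    nlinarith [mul_pos hpos hpos, sq_nonneg (a - c)]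

/-- **The Schur reduction (PROVED direction).** For consecutive primes `q < q′` and an overlap `0 < η < (log q)/2`:
positivity on the OLD cone `C((log q)/2)` (the induction hypothesis = `H` of the previous pair), non-negativity of the
edge block, and the coupling law together give `H(q)`. The decomposition `g = u + h` is by a smooth bump equal to `1`
on `[−(log q)/2 + η, (log q)/2 − η]` and supported in `[−(log q)/2, (log q)/2]`. [this track, ATTEMPT-2 §2] -/
theorem handoffH_of_coupling (hcons : ConsecutivePrimes q q') {η : ℝ} (hη : 0 < η) (hη' : η < Real.log q / 2)
    (hIH : WeilPositivityOn (Real.log q / 2)) (hC : EdgeNonneg q q' η) (hB : HandoffCoupling q q' η) :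
    HandoffH q q' := by
  rw [handoffH_iff_weilPositivityOn hcons]
  intro g hg hsupp
  have hbq : Real.log q / 2 ≤ Real.log q' / 2 := by
    have : (q : ℝ) ≤ q' := by exact_mod_cast hcons.2.2.1.le
    have hq : (0 : ℝ) < q := by exact_mod_cast hcons.1.pos
    linarith [Real.log_le_log hq this]
  -- the bump
  let χ : ContDiffBump (0 : ℝ) := ⟨Real.log q / 2 - η, Real.log q / 2, by linarith, by linarith⟩
  set u : ℝ → ℂ := fun x ↦ (χ x : ℂ) * g x with hu_def
  set h : ℝ → ℂ := fun x ↦ ((1 - χ x : ℝ) : ℂ) * g x with hh_def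
  have hsum : g = u + h := by
    funext x
    simp only [hu_def, hh_def, Pi.add_apply]
    push_cast
    ring
  -- u ∈ C((log q)/2)
  have hu : IsWeilTest u :=
    ⟨(Complex.ofRealCLM.contDiff.comp χ.contDiff).mul hg.1, hg.2.mul_left⟩
  have hus : tsupport u ⊆ Icc (-(Real.log q / 2)) (Real.log q / 2) := by
    have hsub : Function.support u ⊆ ball (0 : ℝ) χ.rOut := by
      intro x hx
      by_contra hx'
      have hχ : χ x = 0 := by
        have hxs : x ∉ Function.support (χ : ℝ → ℝ) := by rw [χ.support_eq]; exact hx'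
        simpa [Function.mem_support] using hxs
      exact hx (by simp [hu_def, hχ])
    have h1 : tsupport u ⊆ closedBall (0 : ℝ) χ.rOut :=
      (closure_mono hsub).trans closure_ball_subset_closedBall
    intro x hx
    have := h1 hx
    rw [Real.closedBall_eq_Icc] at this
    simpa using this
  -- h is an edge-layer function
  have hh : IsEdgeLayer q η (Real.log q' / 2) h := by
    refine ⟨⟨?_, hg.2.mul_left⟩, tsupport_mul_subset_right.trans hsupp, ?_⟩
    · exact (Complex.ofRealCLM.contDiff.comp (contDiff_const.sub χ.contDiff)).mul hg.1
    · intro x hx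
      have hχ : χ x = 1 := χ.one_of_mem_closedBall (by
        rw [mem_closedBall, dist_zero_right, Real.norm_eq_abs]
        exact hx.le)
      simp [hh_def, hχ]
  have ha := hIH u hu hus
  have hc := hC (Real.log q' / 2) ⟨hbq, le_rfl⟩ h hh
  have hb := hB (Real.log q' / 2) ⟨hbq, le_rfl⟩ u h hu hus hh
  rw [hsum, re_weilQuadratic_add]
  exact add_add_two_mul_nonneg_of_sq_le ha hc hb

/-- `crossRe` is the real part of the sesquilinear cross term: `2·crossRe u h = Re(W(u ⋆ h̃) + W(h ⋆ ũ))`.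
[cite: Bombieri2000Weil, §3 (the hermitian form attached to T)] -/
theorem two_mul_crossRe (hu : IsWeilTest u) (hh : IsWeilTest h) :
    2 * crossRe u h =
      (weilFunctional (weilConv u (weilReflect h)) + weilFunctional (weilConv h (weilReflect u))).re := by
  unfold crossRe
  rw [weilQuadratic_add hu hh]
  simp only [Complex.add_re]
  ring

/-- **`Re Q` along a real line**: `Re Q(u + t·h) = Re Q(u) + 2·crossRe(u,h)·t + Re Q(h)·t²` for real `t`
(sesquilinearity: `weilQuadratic_add`, `weilQuadratic_const_mul`, `weilFunctional_const_mul`). [cite: Bombieri2000Weil, §3] -/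
theorem re_weilQuadratic_add_real_mul (hu : IsWeilTest u) (hh : IsWeilTest h) (t : ℝ) :
    (weilQuadratic (u + fun x ↦ (t : ℂ) * h x)).re =
      (weilQuadratic u).re + 2 * crossRe u h * t + (weilQuadratic h).re * t ^ 2 := by
  have hth : IsWeilTest (fun x ↦ (t : ℂ) * h x) := hh.const_mul (t : ℂ)
  rw [weilQuadratic_add hu hth, two_mul_crossRe hu hh, weilQuadratic_const_mul, weilReflect_const_mul,
    Complex.conj_ofReal, weilConv_const_mul_right, weilConv_const_mul_left, weilFunctional_const_mul,
    weilFunctional_const_mul]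
  simp only [Complex.add_re, Complex.mul_re, Complex.ofReal_re, Complex.ofReal_im, Complex.normSq_ofReal,
    zero_mul, sub_zero]
  ring

/-- `a + 2βt + ct² ≥ 0` for all real `t` forces `β² ≤ a·c` (discriminant). [folklore] -/
theorem sq_le_mul_of_forall_nonneg {a β c : ℝ} (h : ∀ t : ℝ, 0 ≤ a + 2 * β * t + c * t ^ 2) : β ^ 2 ≤ a * c := by
  have hd := discrim_le_zero (a := c) (b := 2 * β) (c := a) (fun t ↦ by nlinarith [h t])
  unfold discrim at hd
  nlinarith [hd]

/-- **The coupling law is NECESSARY (Cauchy–Schwarz direction)**: Weil positivity on the big cone `C((log q′)/2)` — in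
particular `H(q)` — implies `HandoffCoupling q q′ η` for every overlap `η`, provided `q ≤ q′` (so that `C((log q)/2)`
sits inside every window cone). [cite: Bombieri2000Weil, §3 (hermitian form ⇒ Cauchy–Schwarz); this track, ATTEMPT-2 §3(iii)] -/
theorem handoffCoupling_of_weilPositivityOn (hq : 0 < q) (hqq' : q ≤ q') (η : ℝ)
    (hW : WeilPositivityOn (Real.log q' / 2)) : HandoffCoupling q q' η := by
  intro b hb u h hu hus hh
  have hqq : Real.log q / 2 ≤ Real.log q' / 2 := by
    have h1 : (q : ℝ) ≤ q' := by exact_mod_cast hqq'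
    have h0 : (0 : ℝ) < q := by exact_mod_cast hq
    linarith [Real.log_le_log h0 h1]
  have hus' : tsupport u ⊆ Icc (-(Real.log q' / 2)) (Real.log q' / 2) :=
    hus.trans (Icc_subset_Icc (neg_le_neg hqq) hqq)
  have hhs' : tsupport h ⊆ Icc (-(Real.log q' / 2)) (Real.log q' / 2) :=
    hh.2.1.trans (Icc_subset_Icc (neg_le_neg hb.2) hb.2)
  have hpoly : ∀ t : ℝ, 0 ≤ (weilQuadratic u).re + 2 * crossRe u h * t + (weilQuadratic h).re * t ^ 2 := by
    intro t
    have hth : IsWeilTest (fun x ↦ (t : ℂ) * h x) := hh.1.const_mul (t : ℂ)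
    have hsum : tsupport (u + fun x ↦ (t : ℂ) * h x) ⊆ Icc (-(Real.log q' / 2)) (Real.log q' / 2) := by
      refine (tsupport_add u (fun x ↦ (t : ℂ) * h x)).trans (union_subset hus' ?_)
      exact tsupport_mul_subset_right.trans hhs'
    rw [← re_weilQuadratic_add_real_mul hu hh.1 t]
    exact hW _ (hu.add hth) hsum
  exact sq_le_mul_of_forall_nonneg hpoly

/-- **The typed crux as an equivalence** (idea-2's L1 «H′(q) [IH] ⟺ EdgePos ∧ WCS»): for consecutive primes `q < q′`,
an overlap `0 < η < (log q)/2`, and GIVEN the induction hypothesis `WeilPositivityOn((log q)/2)`, the window statement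
`H(q)` holds iff the edge block is non-negative and the coupling law holds. [this track, ATTEMPT-2/ATTEMPT-4; IDEAS-explicit-sieve L1] -/
theorem handoffH_iff_edgeNonneg_and_coupling (hcons : ConsecutivePrimes q q') {η : ℝ} (hη : 0 < η)
    (hη' : η < Real.log q / 2) (hIH : WeilPositivityOn (Real.log q / 2)) :
    HandoffH q q' ↔ EdgeNonneg q q' η ∧ HandoffCoupling q q' η := by
  constructor
  · intro H
    have hW : WeilPositivityOn (Real.log q' / 2) := (handoffH_iff_weilPositivityOn hcons).1 H
    refine ⟨fun b hb h hh ↦ hW h hh.1 (hh.2.1.trans (Icc_subset_Icc (neg_le_neg hb.2) hb.2)), ?_⟩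
    exact handoffCoupling_of_weilPositivityOn hcons.1.pos hcons.2.2.1.le η hW
  · rintro ⟨hC, hB⟩
    exact handoffH_of_coupling hcons hη hη' hIH hC hB

/-- **The sliver bound** (ATTEMPT-1 (0.1)), statement: for `g` supported in `[−b, b]` and `0 ≤ x ≤ 2b`, the spike
`k(x) + k(−x)` of `k = g ⋆ g̃` is carried by the slivers of length `ℓ = 2b − x` at the two edges:
`|Re(k(x) + k(−x))| ≤ ∫_{b−ℓ}^{b} |g|² + ∫_{−b}^{−b+ℓ} |g|²`. Elementary (Cauchy–Schwarz); stated here, proof not yet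
filed. [this track, ATTEMPT-1 (0.1)] -/
def SliverBound : Prop :=
  ∀ g : ℝ → ℂ, ∀ b x : ℝ, IsWeilTest g → tsupport g ⊆ Icc (-b) b → 0 ≤ x → x ≤ 2 * b →
    |(weilConv g (weilReflect g) x + weilConv g (weilReflect g) (-x)).re| ≤
      (∫ t in Icc (b - (2 * b - x)) b, ‖g t‖ ^ 2) + ∫ t in Icc (-b) (-b + (2 * b - x)), ‖g t‖ ^ 2

end Summit.RiemannHypothesis.RiemannHypothesis.Theorems.Handoff
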